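import Literature.NumberTheory.LFunctions.StarkNoQuadraticSubfieldGlue
import HarnessLib

/-!
# Stark 1974, Theorem 3: no exceptional zero of `ζ_K` without a quadratic subfield — proof

Topic `Literature/NumberTheory/LFunctions`, namespace
`Literature.NumberTheory.LFunctions.NumberField`. Everything in this file is PROVED (theorems only).

Discharges the named fact `Stark1974_dedekindZeta_ne_zero_of_noQuadraticSubfield`
(`StarkExceptionalZero.lean`, namespace `Literature.NumberTheory.LFunctions.NumberField`): if the
number field `K` of degree `n` has no subfield quadratic over `ℚ`, then `ζ_K(σ) ≠ 0` for
`1 − 1/(4·n!·log|d_K|) ≤ σ < 1`.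

Proof ([MurtyMurty1997, Ch. 2 §6, Cor. 6.2] = [Stark1974, Lemma 3, Thm. 3], assembled from the
tree): let `N₀ ⊆ ℚ̄` be the normal closure of `K/ℚ` and `q : Γ_ℚ → G = Gal(N₀/ℚ)` the restriction
(an `IsArtinQuotient`, glue G8). `[N₀:ℚ] = #G ≤ n!` (G4) and `|d_{N₀}| ≤ |d_K|^{[N₀:ℚ]}` (G5, the
embedded copies of `K` separate `G`, G3), so `σ` lies in Stark's box for `N₀` (G9) and Stark's
Lemma 3 gives `ord_σ ζ_{N₀} ≤ 1` (`meromorphicOrderAt_dedekindZetaCont_le_one`), i.e.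
`n(G, r_G) ≤ 1` (`Heilbronn.artinOrder_leftRegular`). `ζ(σ) < 0` on `(0,1)`, so the base field
contributes no zero. If `ζ_K(σ) = 0` then, `K ≅ ℚ̄^{Γ_E}` being the fixed field of
`H = q(Γ_E) ≤ G` (`E` = an embedded copy of `K`), Heilbronn–Stark
(`Heilbronn.exists_index_two_of_dedekindZetaCont_eq_zero`) yields `H ≤ H₂` with `[G:H₂] = 2`, whose
fixed field is a quadratic subfield of `E ≅ K` (G7) — contradiction.

Design note: for `ℚ̄ = AlgebraicClosure ℚ` and its intermediate fields instance search finds the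
`ℚ`-algebra structure `DivisionRing.toRatAlgebra` first, which is not definitionally (at instance
transparency) the structural one used by the generic Galois-theoretic lemmas; the structural
instances are therefore given local priority in this file, and the one statement consumed with the
canonical structure (G5) is transported along `Subsingleton (Algebra ℚ _)`.

## References

* H. M. Stark, *Some effective cases of the Brauer–Siegel theorem*, Invent. Math. 23 (1974)
  135–152, Lemma 3, Theorem 3. [Stark1974]
* M. R. Murty, V. K. Murty, *Non-vanishing of `L`-functions and applications*, Birkhäuser 1997,
  Ch. 2 §5–§6, Prop. 6.1, Cor. 6.2. [MurtyMurty1997]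
-/

noncomputable section

open scoped NumberField ComplexConjugate ComplexOrder
open Complex NumberField IntermediateField
open Literature.NumberTheory.Automorphic Literature.NumberTheory.LFunctions.Heilbronn

attribute [local instance 1001] AlgebraicClosure.instAlgebra IntermediateField.algebra'
  IntermediateField.module'

namespace Literature.NumberTheory.LFunctions.NumberField

/-! ### Auxiliary transports -/

/-- G5 for an arbitrary `ℚ`-algebra structure on `N` (all such structures coincide,
`Subsingleton (Algebra ℚ N)`): `|d_N| ≤ |d_K|^{[N:ℚ]}` when the embedded copies of `K` separate
`Gal(N/ℚ)`. [folklore] -/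
theorem natAbs_discr_le_pow_of_separating_of_algebra (K : Type*) [Field K] [NumberField K]
    (N : Type*) [Field N] [NumberField N] [alg : Algebra ℚ N] [IsGalois ℚ N]
    (hsep : ∀ s : N ≃ₐ[ℚ] N, s ≠ 1 → ∃ f : K →ₐ[ℚ] N, s ∉ f.fieldRange.fixingSubgroup) :
    (discr N).natAbs ≤ (discr K).natAbs ^ Module.finrank ℚ N := by
  have h : alg = DivisionRing.toRatAlgebra := Subsingleton.elim _ _
  subst h
  exact natAbs_discr_le_pow_of_separating K N hsep

/-- `|d_N| ≥ 3` for `N ≠ ℚ` (Hermite–Minkowski, `NumberField.abs_discr_gt_two`). [folklore] -/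
theorem three_le_natAbs_discr (N : Type*) [Field N] [NumberField N]
    (hN : 1 < Module.finrank ℚ N) : 3 ≤ (discr N).natAbs := by
  have h := NumberField.abs_discr_gt_two hN
  rw [Int.abs_eq_natAbs] at h
  omega

/-- The fixed fields `ℚ̄^{q⁻¹(H)}` are antitone in `H`. [folklore] -/
theorem quotientFixedField_antitone {F : Type} [Field F] {G : Type} [Group G]
    {q : Field.absoluteGaloisGroup F →* G} {H H' : Subgroup G} (h : H ≤ H') :
    quotientFixedField q H' ≤ quotientFixedField q H := by
  intro x hx
  change x ∈ IntermediateField.fixedField _ at hx ⊢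
  rw [IntermediateField.mem_fixedField_iff] at hx ⊢
  exact fun g hg => hx g (Subgroup.comap_mono h hg)

/-! ### The theorem -/

/-- **Stark 1974, Theorem 3 (with Lemma 3) = Murty–Murty Ch. 2, Cor. 6.2 (consequence): no
exceptional zero of `ζ_K` when `K` has no quadratic subfield** — the named fact
`Stark1974_dedekindZeta_ne_zero_of_noQuadraticSubfield` holds: if the number field `K` of degree
`n` has no subfield quadratic over `ℚ`, then `ζ_K(σ) ≠ 0` for every real `σ` with
`1 − 1/(4·n!·log|d_K|) ≤ σ < 1`. Assembled from Heilbronn–Stark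
(`Heilbronn.exists_index_two_of_dedekindZetaCont_eq_zero`), Stark's Lemma 3
(`Stark1974_atMostOneZero_holds`, via `meromorphicOrderAt_dedekindZetaCont_le_one`) and the glue
G1–G9 of `StarkNoQuadraticSubfieldGlue.lean`; see the module docstring.
[cite: Stark1974, Thm. 3] [cite: MurtyMurty1997, Ch. 2 Cor. 6.2] -/
theorem Stark1974_dedekindZeta_ne_zero_of_noQuadraticSubfield_holds :
    Stark1974_dedekindZeta_ne_zero_of_noQuadraticSubfield := by
  intro K _ _ hK σ hσ hσ1 h0
  classical
  -- degree one: `|d_K| = 1`, the interval is empty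
  rcases le_or_gt (Module.finrank ℚ K) 1 with h1 | h2
  · have h1' : Module.finrank ℚ K = 1 := le_antisymm h1 Module.finrank_pos
    have hlog : Real.log ((1 : ℕ) : ℝ) = 0 := by simp
    rw [natAbs_discr_eq_one_of_finrank_eq_one h1', hlog, mul_zero, div_zero, sub_zero] at hσ
    exact absurd hσ1 (not_lt.mpr hσ)
  -- degree `n ≥ 2`: `|d_K| ≥ 3`, `0 < σ < 1`
  have hdK : 3 ≤ (discr K).natAbs := three_le_natAbs_discr K h2
  have hk : 2 ≤ (Module.finrank ℚ K).factorial := by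
    have h := Nat.factorial_le (Nat.succ_le_of_lt h2)
    rwa [Nat.factorial_two] at h
  have hσ0 : 0 < σ := pos_of_one_sub_inv_log_le hdK hk hσ
  have hs1 : (σ : ℂ) ≠ 1 := fun h => hσ1.ne (by exact_mod_cast h)
  have hreal : conj (σ : ℂ) = σ := Complex.conj_ofReal σ
  -- the normal closure `N₀` of `K` inside `ℚ̄`, an embedded copy `E = f(K)`, `q : Γ_ℚ → Gal(N₀/ℚ)`
  let L := AlgebraicClosure ℚ
  let N₀ : IntermediateField ℚ L := normalClosure ℚ K L
  let f : K →ₐ[ℚ] L := IsAlgClosed.lift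
  have hE : f.fieldRange ≤ N₀ := f.fieldRange_le_normalClosure
  obtain ⟨q, hq⟩ : ∃ q : Field.absoluteGaloisGroup ℚ →* (N₀ ≃ₐ[ℚ] N₀),
      q = AlgEquiv.restrictNormalHom N₀ := ⟨_, rfl⟩
  have hqA : IsArtinQuotient q := isArtinQuotient_of_eq_restrictNormalHom hq
  haveI hNF : ∀ H', NumberField (quotientFixedField q H') :=
    fun H' => numberField_quotientFixedField hqA H'
  set H : Subgroup (N₀ ≃ₐ[ℚ] N₀) := (f.fieldRange.fixingSubgroup).map q
  have hHE : quotientFixedField q H = f.fieldRange := quotientFixedField_map_fixingSubgroup hq hE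
  have hbot : quotientFixedField q ⊥ = N₀ := quotientFixedField_bot_of_eq_restrictNormalHom hq
  have htop' : quotientFixedField q ⊤ = ⊥ := quotientFixedField_top_eq_bot (q := q)
  -- `N₀/ℚ` is a Galois number field of degree `#Gal(N₀/ℚ) ≤ n!` containing a copy of `K`
  haveI : IsGalois ℚ N₀ :=
    { to_isSeparable := Algebra.isSeparable_tower_bot_of_isSeparable ℚ N₀ L }
  haveI : NumberField N₀ := NumberField.of_module_finite ℚ N₀
  have eK : K ≃ₐ[ℚ] f.fieldRange := f.equivFieldRange
  have hKN : Module.finrank ℚ K ≤ Module.finrank ℚ N₀ := by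
    rw [eK.toLinearEquiv.finrank_eq]
    exact IntermediateField.finrank_le_of_le_right hE
  have hN1 : 1 < @Module.finrank ℚ N₀ _ _ DivisionRing.toRatAlgebra.toModule :=
    lt_of_lt_of_le h2 (hKN.trans_eq (finrank_rat_eq_finrank_rat _ _))
  have hm : Module.finrank ℚ N₀ ≤ (Module.finrank ℚ K).factorial := by
    rw [← IsGalois.card_aut_eq_finrank ℚ N₀, Nat.card_eq_fintype_card]
    exact card_algEquiv_normalClosure_le_factorial ℚ K L
  -- `|d_{N₀}| ≤ |d_K|^{[N₀:ℚ]}`, so `σ` lies in Stark's box for `N₀`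
  have hdisc : (discr N₀).natAbs ≤ (discr K).natAbs ^ Module.finrank ℚ N₀ :=
    natAbs_discr_le_pow_of_separating_of_algebra K N₀
      fun s hs => exists_not_mem_fixingSubgroup_fieldRange ℚ K L hs
  have hdN : 3 ≤ (discr N₀).natAbs := three_le_natAbs_discr N₀ hN1
  have hσN : 1 - 1 / (4 * Real.log ((discr N₀).natAbs : ℝ)) ≤ σ :=
    one_sub_inv_log_le (by omega) (by omega) hdisc hm hσ
  have hbox : (σ : ℂ) ∈ starkBox ((discr N₀).natAbs : ℝ) :=
    ofReal_mem_starkBox (by exact_mod_cast (show 1 ≤ (discr N₀).natAbs by omega)) hσN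
  -- `ord_σ ζ_{N₀} ≤ 1` (Stark's Lemma 3), as `n(G, r_G) ≤ 1`
  have e3 : quotientFixedField q (⊥ : Subgroup (N₀ ≃ₐ[ℚ] N₀)) ≃+* N₀ :=
    (IntermediateField.equivOfEq hbot).toRingEquiv
  have hle :
      artinOrder (σ : ℂ) ((Representation.leftRegular ℂ (N₀ ≃ₐ[ℚ] N₀)).character ∘ q) ≤ 1 := by
    have h1 := artinOrder_leftRegular hqA (σ : ℂ)
    rw [meromorphicOrderAt_dedekindZetaCont_eq_of_ringEquiv e3 hs1] at h1
    have h3 := meromorphicOrderAt_dedekindZetaCont_le_one N₀ hN1 hs1 hbox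
    rw [← h1] at h3
    exact_mod_cast h3
  -- `ζ_ℚ(σ) = ζ(σ) < 0`
  have e2 : quotientFixedField q (⊤ : Subgroup (N₀ ≃ₐ[ℚ] N₀)) ≃+* ℚ :=
    ((IntermediateField.equivOfEq htop').trans (IntermediateField.botEquiv ℚ L)).toRingEquiv
  have htop : dedekindZetaCont (quotientFixedField q (⊤ : Subgroup (N₀ ≃ₐ[ℚ] N₀))) σ ≠ 0 := by
    rw [dedekindZetaCont_eq_of_ringEquiv e2 hs1, dedekindZetaCont_rat_eq_riemannZeta_holds hs1]
    exact (riemannZeta_neg_of_pos_of_lt_one hσ0 hσ1).ne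
  -- `ζ_{F_H}(σ) = ζ_K(σ) = 0`
  have e1 : quotientFixedField q H ≃+* K :=
    ((IntermediateField.equivOfEq hHE).trans eK.symm).toRingEquiv
  have hH0 : dedekindZetaCont (quotientFixedField q H) σ = 0 := by
    rw [dedekindZetaCont_eq_of_ringEquiv e1 hs1]
    exact h0
  -- Heilbronn–Stark: `H ≤ H₂` of index `2`; its fixed field is a quadratic subfield of `E ≅ K`
  obtain ⟨H₂, hH₂, hidx⟩ :=
    exists_index_two_of_dedekindZetaCont_eq_zero hqA hs1 hreal hle htop H hH0
  have h2' : Module.finrank ℚ (quotientFixedField q H₂) = 2 :=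
    (finrank_quotientFixedField hqA H₂).trans hidx
  have hle2 : quotientFixedField q H₂ ≤ f.fieldRange :=
    hHE ▸ quotientFixedField_antitone hH₂
  obtain ⟨F', hF'⟩ := exists_intermediateField_finrank_eq_two f hle2 h2'
  exact hK F' hF'

end Literature.NumberTheory.LFunctions.NumberField

end
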